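import Summits.CriticalPhenomena.PercolationContinuityZ3.Theorems.PercAnnulusCrossingIICPointHarris
import Summits.CriticalPhenomena.PercolationContinuityZ3.Theorems.PercAnnulusCrossingIICTwoPointUpper
import Summits.CriticalPhenomena.PercolationContinuityZ3.Theorems.PercAnnulusCrossingIICLocalLimit
import HarnessLib

/-!
# The IIC two-point function `ν(0 ↔ z) ≍ π(‖z‖)` under (A2)□ + `CU⁺_l` alone, and the mean IIC mass in a far ball (lane RSW3, p1 gen 22)

builds on p205010 (kernel theorem, internal audit signed; external expert review pending) — NOT used in this file (only `p_c(ℤ^d) > 0`).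

RSW3 lane (LANE 3 `prim-rsw3`), seat `prim-rsw3-p1` (gen 22).  Helper file (`--supports stmt-CriticalPhenomena-4575`); no definitions,
no sorries.  Memo `run/shared/lean/prim/rsw3/P1-QM.md` §35.

Gen 18/19 (`…IICTwoPointLower`, `…IICTwoPointSandwich`) proved `c·π(‖z‖) ≤ ν(0 ↔ z) ≤ C·π(‖z‖)` under (A2)□ + `CU⁺_l` + UAD.  The quasi-Harris
inequality of `…IICPointHarris` (with `E = univ`) gives the lower half WITHOUT the annulus-decay hypothesis, so:

* **`exists_iicMeasure_real_openConn_two_sided_noDecay_criticalProbI`** — at `p_c(ℤ^d)`, `d ≥ 2`, under (A2)□(s,L) + `CU⁺_l` ONLY: there are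
  `n₀ ≥ 1` and `0 < c, C` with **`c·π_{p_c}(n) ≤ ν(0 ↔ z) ≤ C·π_{p_c}(n)`** for every finite measure `ν` with Kesten's IIC limit property and every
  `z` with `‖z‖_∞ = n ≥ n₀`;
* **`exists_iicMeasure_sum_ball_real_openConn_two_sided_criticalProbI`** — hence the MEAN MASS OF THE IIC IN A FAR BALL:
  **`c·(2m+1)^d·π_{p_c}(‖x‖) ≤ Σ_{y ∈ Λ_x(m)} ν(0 ↔ y) ≤ C·(2m+1)^d·π_{p_c}(‖x‖)`** for `2m ≤ ‖x‖`, `‖x‖ ≥ 2n₀`, i.e.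
  `E_ν[#(C(0) ∩ Λ_x(m))] ≍ m^d·π(‖x‖)`; with `…IICNearPoint` (`ν(C(0) ∩ Λ_x(m) ≠ ∅) ≍ π(‖x‖)/π(m)`): GIVEN THAT THE IIC COMES WITHIN DISTANCE `m`
  OF `x`, IT LEAVES `≍ m^d π(m)` SITES THERE — the mass of an IIC ball of radius `m`.
References: H. Kesten, PTRF 73 (1986) Thm. (8); D. Basu, A. Sapozhnikov, ECP 22 (2017) Thm. 1.1.
-/

noncomputable section

namespace Summit.CriticalPhenomena.PercolationContinuityZ3.Theorems.Crossing

open MeasureTheory Filter Topology Literature.Probability.Percolation Literature.Probability.LatticeModels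
open Literature.Probability.Percolation.DCT16
open Summit.CriticalPhenomena.PercolationContinuityZ3.Theorems.SurfaceTension

variable {d : ℕ}

/-- **THE IIC TWO-POINT FUNCTION IS `≍ π` UNDER (A2)□ + `CU⁺_l` ALONE** (`p_c(ℤ^d)`, `d ≥ 2`; (A2)□ at aspect `(s,L)`, `2 ≤ s ≤ L`, `ϰ > 0`;
`CU⁺_l(c_U)`, `l ≥ 2`, `c_U > 0`; NO annulus decay): there are `n₀ ≥ 1` and `0 < c, C` such that for every finite measure `ν` with Kesten's IIC
limit property and every site `z` with `‖z‖_∞ = n ≥ n₀`: **`c·π_{p_c}(n) ≤ ν(0 ↔ z) ≤ C·π_{p_c}(n)`** (lower: the quasi-Harris inequality with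
`E = univ` and `ν(univ) = 1`; upper: gen 7 with the ratio bound `π(⌊(n−1)/2⌋) ≤ B·π(n)`). [cite: Kesten1986, Thm. (8)] [cite: BasuSapozhnikov2017ECP, Thm. 1.1] -/
theorem exists_iicMeasure_real_openConn_two_sided_noDecay_criticalProbI (hd : 2 ≤ d) {s L : ℕ} (hs : 2 ≤ s) (hsL : s ≤ L)
    {ϰ : ℝ} (hϰ : 0 < ϰ) (hA2 : SetToSetQuasiMultAspectAt d (criticalProbI d) s L ϰ) {l : ℕ} (hl : 2 ≤ l) {cU : ℝ} (hcU : 0 < cU)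
    (hCU : ∀ a : ℕ, 1 ≤ a → ∀ E : Set (BondConfig (Site d)), IsUpperSet E → MeasurableSet E →
      cU * (bondPercolation (zdGraph d) (criticalProbI d)).real E ≤ (bondPercolation (zdGraph d) (criticalProbI d)).real (E ∩
        {ω : BondConfig (Site d) | ∀ t ∈ innerBoundary (zdGraph d) (box d a), ∀ s ∈ innerBoundary (zdGraph d) (box d (l * a)),
          ∀ t' ∈ innerBoundary (zdGraph d) (box d a), ∀ s' ∈ innerBoundary (zdGraph d) (box d (l * a)),
          ω ∈ openConnIn (↑((box d (l * a) \ box d a) ∪ innerBoundary (zdGraph d) (box d a)) : Set (Site d)) t s →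
          ω ∈ openConnIn (↑((box d (l * a) \ box d a) ∪ innerBoundary (zdGraph d) (box d a)) : Set (Site d)) t' s' →
          ω ∈ openConnIn (↑((box d (l * a) \ box d a) ∪ innerBoundary (zdGraph d) (box d a)) : Set (Site d)) s s'})) :
    ∃ (n₀ : ℕ) (c C : ℝ), 1 ≤ n₀ ∧ 0 < c ∧ 0 < C ∧ ∀ (ν : Measure (BondConfig (Site d))) [IsFiniteMeasure ν],
      (∀ (F : Finset (Sym2 (Site d))) (E : Set (BondConfig (Site d))), MeasurableSet E → DeterminedBy E ↑F →
        Tendsto (fun n : ℕ => (bondPercolation (zdGraph d) (criticalProbI d)).real (E ∩ siteToBoundary d n) /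
          oneArmProb d (criticalProbI d) n) atTop (𝓝 (ν.real E))) →
      ∀ (n : ℕ) (z : Site d), n₀ ≤ n → z ∈ sphere d n →
        c * oneArmProb d (criticalProbI d) n ≤ ν.real (openConn 0 z) ∧
          ν.real (openConn 0 z) ≤ C * oneArmProb d (criticalProbI d) n := by
  have hd1 : 1 ≤ d := le_trans (by norm_num) hd
  have hp : 0 < ((criticalProbI d : unitInterval) : ℝ) := by
    rw [coe_criticalProbI]; exact criticalProb_zd_pos d hd1
  have hπ : ∀ m : ℕ, 0 < oneArmProb d (criticalProbI d) m := fun m => oneArmProb_pos hd1 _ hp m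
  obtain ⟨c, hc, hlow⟩ := exists_iicMeasure_real_inter_openConn_ge_mul_of_isUpperSet_criticalProbI hd hs hsL hϰ hA2 hl hcU hCU
  obtain ⟨C, hC, hup⟩ := iicMeasure_real_openConn_le_criticalProbI hd hs hsL hϰ hA2
  obtain ⟨B, hB, hR⟩ := Rsw3.exists_oneArmProb_ratio_of_setToSetQuasiMultAspectAt hd hs hsL hϰ hA2
  refine ⟨7, c, C * B, by norm_num, hc, by positivity, fun ν _ hν n z hn hz => ⟨?_, ?_⟩⟩
  · have hzn : Site.supNorm z = n := mem_sphere.1 hz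
    have h := hlow ν hν z Set.univ isUpperSet_univ isLocalEvent_univ (by omega)
    rw [iicMeasure_real_univ hd1 _ hp hν, mul_one, Set.univ_inter, hzn] at h
    exact h
  · have h := hup ν hν n z hn hz
    have hratio : oneArmProb d (criticalProbI d) ((n - 1) / 2) ≤ B * oneArmProb d (criticalProbI d) n :=
      hR ((n - 1) / 2) n (by omega) (by omega) (by omega)
    calc ν.real (openConn 0 z) ≤ C * oneArmProb d (criticalProbI d) ((n - 1) / 2) := h
      _ ≤ C * (B * oneArmProb d (criticalProbI d) n) := mul_le_mul_of_nonneg_left hratio hC.le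
      _ = C * B * oneArmProb d (criticalProbI d) n := by ring

open Classical in
/-- **THE MEAN MASS OF THE IIC IN A FAR BALL: `Σ_{y ∈ Λ_x(m)} ν(0 ↔ y) ≍ (2m+1)^d·π(‖x‖)`** (`p_c(ℤ^d)`, `d ≥ 2`; (A2)□(s,L) + `CU⁺_l`): there are
`n₀ ≥ 1` and `0 < c, C` such that for every finite measure `ν` with Kesten's IIC limit property, every `m` and every `x` with `2m ≤ ‖x‖_∞` and
`‖x‖_∞ ≥ 2n₀`: **`c·(2m+1)^d·π_{p_c}(‖x‖) ≤ Σ_{y ∈ x + Λ(m)} ν(0 ↔ y) ≤ C·(2m+1)^d·π_{p_c}(‖x‖)`** (every `y ∈ Λ_x(m)` has `‖x‖ − m ≤ ‖y‖ ≤ ‖x‖ + m`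
and the ratio bound). [cite: Kesten1986, Thm. (8)] -/
theorem exists_iicMeasure_sum_ball_real_openConn_two_sided_criticalProbI (hd : 2 ≤ d) {s L : ℕ} (hs : 2 ≤ s) (hsL : s ≤ L)
    {ϰ : ℝ} (hϰ : 0 < ϰ) (hA2 : SetToSetQuasiMultAspectAt d (criticalProbI d) s L ϰ) {l : ℕ} (hl : 2 ≤ l) {cU : ℝ} (hcU : 0 < cU)
    (hCU : ∀ a : ℕ, 1 ≤ a → ∀ E : Set (BondConfig (Site d)), IsUpperSet E → MeasurableSet E →
      cU * (bondPercolation (zdGraph d) (criticalProbI d)).real E ≤ (bondPercolation (zdGraph d) (criticalProbI d)).real (E ∩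
        {ω : BondConfig (Site d) | ∀ t ∈ innerBoundary (zdGraph d) (box d a), ∀ s ∈ innerBoundary (zdGraph d) (box d (l * a)),
          ∀ t' ∈ innerBoundary (zdGraph d) (box d a), ∀ s' ∈ innerBoundary (zdGraph d) (box d (l * a)),
          ω ∈ openConnIn (↑((box d (l * a) \ box d a) ∪ innerBoundary (zdGraph d) (box d a)) : Set (Site d)) t s →
          ω ∈ openConnIn (↑((box d (l * a) \ box d a) ∪ innerBoundary (zdGraph d) (box d a)) : Set (Site d)) t' s' →
          ω ∈ openConnIn (↑((box d (l * a) \ box d a) ∪ innerBoundary (zdGraph d) (box d a)) : Set (Site d)) s s'})) :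
    ∃ (n₀ : ℕ) (c C : ℝ), 1 ≤ n₀ ∧ 0 < c ∧ 0 < C ∧ ∀ (ν : Measure (BondConfig (Site d))) [IsFiniteMeasure ν],
      (∀ (F : Finset (Sym2 (Site d))) (E : Set (BondConfig (Site d))), MeasurableSet E → DeterminedBy E ↑F →
        Tendsto (fun n : ℕ => (bondPercolation (zdGraph d) (criticalProbI d)).real (E ∩ siteToBoundary d n) /
          oneArmProb d (criticalProbI d) n) atTop (𝓝 (ν.real E))) →
      ∀ (m : ℕ) (x : Site d), 2 * m ≤ Site.supNorm x → 2 * n₀ ≤ Site.supNorm x →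
        c * ((2 * m + 1 : ℕ) : ℝ) ^ d * oneArmProb d (criticalProbI d) (Site.supNorm x) ≤
            ∑ y ∈ (box d m).image (· + x), ν.real (openConn 0 y) ∧
          ∑ y ∈ (box d m).image (· + x), ν.real (openConn 0 y) ≤
            C * ((2 * m + 1 : ℕ) : ℝ) ^ d * oneArmProb d (criticalProbI d) (Site.supNorm x) := by
  obtain ⟨n₀, c, C, hn₀, hc, hC, htp⟩ := exists_iicMeasure_real_openConn_two_sided_noDecay_criticalProbI hd hs hsL hϰ hA2 hl hcU hCU
  obtain ⟨B, hB, hR⟩ := Rsw3.exists_oneArmProb_ratio_of_setToSetQuasiMultAspectAt hd hs hsL hϰ hA2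
  refine ⟨n₀, c / B, C * B, hn₀, by positivity, by positivity, fun ν _ hν m x hm hx => ?_⟩
  set n := Site.supNorm x with hn
  -- the translated ball has `(2m+1)^d` sites, each with `n − m ≤ ‖y‖ ≤ n + m`
  have hinj : Set.InjOn (fun w : Site d => w + x) ↑(box d m) := fun a _ b _ h => add_right_cancel h
  have hcard : (((box d m).image (· + x)).card : ℝ) = ((2 * m + 1 : ℕ) : ℝ) ^ d := by
    rw [Finset.card_image_of_injOn hinj, card_box]; push_cast; ring
  have hnorm : ∀ y ∈ (box d m).image (· + x), n - m ≤ Site.supNorm y ∧ Site.supNorm y ≤ n + m := by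
    intro y hy
    obtain ⟨w, hw, rfl⟩ := Finset.mem_image.1 hy
    have h1 := mem_box_iff_supNorm_le.1 hw
    have h2 : Site.supNorm (w + x) ≤ Site.supNorm w + Site.supNorm x := Site.supNorm_add_le w x
    have h3 : Site.supNorm x ≤ Site.supNorm (w + x) + Site.supNorm w := by
      have h := Site.supNorm_add_le (w + x) (-w)
      rwa [Site.supNorm_neg, add_neg_cancel_comm] at h
    constructor <;> omega
  have hterm : ∀ y ∈ (box d m).image (· + x),
      c / B * oneArmProb d (criticalProbI d) n ≤ ν.real (openConn 0 y) ∧ ν.real (openConn 0 y) ≤ C * B * oneArmProb d (criticalProbI d) n := by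
    intro y hy
    obtain ⟨h1, h2⟩ := hnorm y hy
    have hy0 : n₀ ≤ Site.supNorm y := by omega
    obtain ⟨hlo, hhi⟩ := htp ν hν (Site.supNorm y) y hy0 (mem_sphere.2 rfl)
    -- ratio bounds: `π(n) ≤ B π(‖y‖)` when `‖y‖ ≤ n` ... in both directions via `n − m ≤ ‖y‖ ≤ n + m ≤ 8(n − m)`
    have hup' : oneArmProb d (criticalProbI d) (Site.supNorm y) ≤ B * oneArmProb d (criticalProbI d) n := by
      by_cases hyn : Site.supNorm y ≤ n
      · -- `‖y‖ ≤ n ≤ 8‖y‖`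
        exact hR _ _ (by omega) hyn (by omega)
      · -- `n < ‖y‖`: `π(‖y‖) ≤ π(n) ≤ B π(n)` (`B ≥ 1` from `π(n) ≤ B π(n)`)
        have hB1 : oneArmProb d (criticalProbI d) n ≤ B * oneArmProb d (criticalProbI d) n := hR n n (by omega) le_rfl (by omega)
        exact (real_siteToBoundary_antitone _ (by omega)).trans hB1
    have hlo' : oneArmProb d (criticalProbI d) n ≤ B * oneArmProb d (criticalProbI d) (Site.supNorm y) := by
      by_cases hyn : n ≤ Site.supNorm y
      · exact hR _ _ (by omega) hyn (by omega)
      · have hB1 : oneArmProb d (criticalProbI d) (Site.supNorm y) ≤ B * oneArmProb d (criticalProbI d) (Site.supNorm y) :=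
          hR _ _ (by omega) le_rfl (by omega)
        exact (real_siteToBoundary_antitone _ (by omega)).trans hB1
    constructor
    · rw [div_mul_eq_mul_div, div_le_iff₀ hB]
      calc c * oneArmProb d (criticalProbI d) n ≤ c * (B * oneArmProb d (criticalProbI d) (Site.supNorm y)) :=
            mul_le_mul_of_nonneg_left hlo' hc.le
        _ = c * oneArmProb d (criticalProbI d) (Site.supNorm y) * B := by ring
        _ ≤ ν.real (openConn 0 y) * B := mul_le_mul_of_nonneg_right hlo hB.le
    · calc ν.real (openConn 0 y) ≤ C * oneArmProb d (criticalProbI d) (Site.supNorm y) := hhi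
        _ ≤ C * (B * oneArmProb d (criticalProbI d) n) := mul_le_mul_of_nonneg_left hup' hC.le
        _ = C * B * oneArmProb d (criticalProbI d) n := by ring
  refine ⟨?_, ?_⟩
  · calc c / B * ((2 * m + 1 : ℕ) : ℝ) ^ d * oneArmProb d (criticalProbI d) n
        = ∑ _y ∈ (box d m).image (· + x), c / B * oneArmProb d (criticalProbI d) n := by
          rw [Finset.sum_const, nsmul_eq_mul, hcard]; ring
      _ ≤ _ := Finset.sum_le_sum fun y hy => (hterm y hy).1
  · calc ∑ y ∈ (box d m).image (· + x), ν.real (openConn 0 y)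
        ≤ ∑ _y ∈ (box d m).image (· + x), C * B * oneArmProb d (criticalProbI d) n := Finset.sum_le_sum fun y hy => (hterm y hy).2
      _ = C * B * ((2 * m + 1 : ℕ) : ℝ) ^ d * oneArmProb d (criticalProbI d) n := by
          rw [Finset.sum_const, nsmul_eq_mul, hcard]; ring

end Summit.CriticalPhenomena.PercolationContinuityZ3.Theorems.Crossing

end
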